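import Mathlib
import Summits.NavierStokesRegularity.NavierStokesRegularity.Theorems.FilamentSkeletonRssDefectColumnGateAzimuthalBlockRotationFlux

/-!
# Route `FilamentSkeletonRss` · crux `TransverseReduction1AG` (stmt-NavierStokesRegularity-27853; A1L twin stmt-23297) · line
# `defect_column_gate_1AG/1AL` — the GAUSSIAN-CORE ROTATION COERCIVITY of the Biot–Savart-coupled azimuthal blocks `m ≥ 2` of the
# localised sectional waist gate `WaistColumnGateLoc1A` (stub S2a-loc): the exact angular-momentum identity with the column's differential
# rotation AND its Biot–Savart coupling, and the `1/Rc` gain in the Gaussian weight, for EVERY circulation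

Helper file (`--supports stmt-NavierStokesRegularity-27853 --as helper`; seat ns-filament-s2aloc-p1 g2, MINT req187 no-hit branch; the core zone
of the seat's note ARCHITECTURE-B2B3-s2aloc-g2.md §2(c)/§4, evidence #52 on 27853 / #13 on 23297).  Companions: `…AzimuthalBlock.lean` (p671383),
`…AzimuthalBlockExterior.lean` (p671778), `…AzimuthalBlockRotationFlux.lean` (the rotation lever without Biot–Savart).

THE COUPLED BLOCK.  In `u = r²`, vorticity coefficient `w = a + ib` and stream coefficient `φ = φ_a + iφ_b` of `e^{imθ}` (`m ≥ 2`) of an axially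
constant horizontal perturbation of the SYMMETRIC column of circulation `Rc` in a frame rotating at rate `ρ`:
`Φ_a′ = (m²/u)a − V b + c_B φ_b − f₁`, `Φ_b′ = (m²/u)b + V a − c_B φ_a − f₂`, `Φ_a = 4u a′ + γu a`, `Φ_b = 4u b′ + γu b`,
`V = m(ρ + Rc·Ω)`, `Ω(u) = (1 − e^{−γu/4})/(2πu)` (angular velocity of the unit Gaussian column), `c_B = (γ m Rc/2)·(γ/4π)e^{−γu/4}` (the
Biot–Savart coupling `−(G′/r)`, `G = (γ/4π)e^{−γr²/4}`), and the `m`-Poisson relation in flux form `(u φ_a′)′ = ((m²/u)φ_a − a)/4` (`w = −Δ_m φ`).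
This is `L_OU w + i m ρ w + i m Rc[Ω w − (γ/2)G φ] = f` — the frozen sectional operator of `colForceVort_eq` on the mode, INCLUDING the
nonlocal column term (sign check: it annihilates the translation mode `w = G′, φ = −rΩ`, p664587).

THE RESULTS (all for every `Rc ≥ 0`, every support radius `U`, every `ρ`).
(1) `core_rotation_identity`: `∫₀^U e^{γu/4} V·(a²+b²) = ∫₀^U e^{γu/4}(a f₂ − b f₁) + (γ²mRc/8π)·∫₀^U (aφ_a + bφ_b)` — the Gaussian weight makes
the OU part invisible (`…RotationFlux`), and `e^{γu/4}·c_B ≡ γ²mRc/8π` makes the Biot–Savart weight CONSTANT.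
(2) `bsPairing_integral`: `∫₀^U aφ_a = ∫₀^U (4u φ_a′² + (m²/u)φ_a²) ≥ 0` and `≤ (1/m²)∫₀^U u a²` (`bsPairing_le`).
(3) `core_rotation_coercivity`: for `m ≥ 2`,
`(1 − 16/(5m²))·m Rc ∫₀^U e^{γu/4} Ω (a²+b²) + mρ ∫₀^U e^{γu/4}(a²+b²) ≤ ∫₀^U e^{γu/4}(a f₂ − b f₁)`,
from the pointwise bound `(5/4)x² ≤ eˣ − 1` (`five_quarters_sq_le_exp_sub_one`), i.e. `(γ/2)G/Ω ≤ (16/5)/u = (4/5)·(m²/u)` at `m = 2`: the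
Biot–Savart part of `⟨Λw, w⟩` is at most `16/(5m²) < 1` of the rotation part (the 1-D shadow of Arnold/Gallay–Wayne positivity; for `m = 1` the
ratio is exactly 1 on the translation mode, which is why `m ≥ 2`).  CONSEQUENCE: in the Gaussian weight the column's rotation controls
`Rc·∫ e^{γu/4}Ω|w|²` by the forcing alone — a `1/Rc` GAIN with NO enhanced-dissipation input, valid on the imaginary axis at the frame
frequency.  The weight `e^{γu/4}` is affordable only on `u ≲ (4A/γ)log Rc`; the seat's note explains how the V-blind exterior lemma (p671778)
takes over beyond (two-zone scheme), which is NOT done here.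
HYPOTHESES are LEAD-style: values and first derivatives on `(0, U)`, continuity of the unknowns and of the fluxes on `[0, U]`, interval
integrability of the integrands that occur (all continuous in the intended dictionary), vanishing of `a, b, φ_a, φ_b` at `U`.
HONEST FRAMING: identities/inequalities about ONE family of blocks of ONE linear MODEL operator of a hypothetical blow-up route (MODEL rung,
negative side); `WaistColumnGateLoc1A`, `TransverseReduction1AG/1AL` are neither proved nor refuted here; nothing here bears on NS regularity.
-/

set_option linter.dupNamespace false

noncomputable section

namespace Summit.NavierStokesRegularity.NavierStokesRegularity.Theorems.DefectColumnGate

open scoped Topology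
open Set Filter MeasureTheory intervalIntegral

/-! ## 1. Elementary inequalities -/

/-- `(5/4)x² ≤ eˣ − 1` for `x ≥ 0` (from `1 + x + x²/2 + x³/6 ≤ eˣ`: the difference is `x(1 − 3x/4 + x²/6) ≥ 0`). -/
theorem five_quarters_sq_le_exp_sub_one {x : ℝ} (hx : 0 ≤ x) : 5 / 4 * x ^ 2 ≤ Real.exp x - 1 := by
  have h := Real.sum_le_exp_of_nonneg hx 4
  simp only [Finset.sum_range_succ, Finset.sum_range_zero, Nat.factorial, pow_zero, pow_one, zero_add,
    Nat.cast_one, div_one] at h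
  norm_num at h
  nlinarith [sq_nonneg (x - 9 / 4), mul_nonneg hx (sq_nonneg x), hx]

/-- The Biot–Savart/rotation comparison in `u = r²`: for `γ > 0`, `m ≥ 2`, `u ≥ 0`,
`(γ²/(8πm))·u ≤ (16/(5m²))·m·(e^{γu/4} − 1)/(2πu)` — i.e. `(γ/2)G/Ω ≤ (16/(5m²))·(m²/u)`. -/
theorem bs_rotation_pointwise {γ m u : ℝ} (hγ : 0 < γ) (hm : 2 ≤ m) (hu : 0 ≤ u) :
    γ ^ 2 / (8 * Real.pi * m) * u ≤ 16 / (5 * m ^ 2) * m * ((Real.exp (γ * u / 4) - 1) / (2 * Real.pi * u)) := by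
  have hm0 : 0 < m := by linarith
  have hπ : 0 < Real.pi := Real.pi_pos
  rcases eq_or_lt_of_le hu with h | h
  · subst h; simp
  · have hx : 0 ≤ γ * u / 4 := by positivity
    have key := five_quarters_sq_le_exp_sub_one hx
    have hsq : (γ * u / 4) ^ 2 = γ ^ 2 * u ^ 2 / 16 := by ring
    rw [hsq] at key
    have key' : 5 * γ ^ 2 * u ^ 2 ≤ 64 * (Real.exp (γ * u / 4) - 1) := by linarith
    have e : 16 / (5 * m ^ 2) * m * ((Real.exp (γ * u / 4) - 1) / (2 * Real.pi * u)) - γ ^ 2 / (8 * Real.pi * m) * u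
        = (64 * (Real.exp (γ * u / 4) - 1) - 5 * γ ^ 2 * u ^ 2) / (40 * Real.pi * m * u) := by
      field_simp
      ring
    have hnn : 0 ≤ (64 * (Real.exp (γ * u / 4) - 1) - 5 * γ ^ 2 * u ^ 2) / (40 * Real.pi * m * u) :=
      div_nonneg (by linarith) (by positivity)
    linarith [e, hnn]

/-! ## 2. The Biot–Savart pairing `∫ aφ_a` -/

/-- **Biot–Savart pairing, pointwise flux.**  If `(u φ₁)′ = ((m²/u)φ − a)/4` and `φ′ = φ₁` at `u` then
`(−4u φ₁ φ)′ = aφ − 4u φ₁² − (m²/u)φ²`. -/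
theorem bsPairing_hasDerivAt {m u : ℝ} {a φ φ₁ : ℝ → ℝ}
    (hder : HasDerivAt φ (φ₁ u) u) (hP : HasDerivAt (fun s => s * φ₁ s) ((m ^ 2 / u * φ u - a u) / 4) u) :
    HasDerivAt (fun s => -4 * (s * φ₁ s) * φ s) (a u * φ u - 4 * u * φ₁ u ^ 2 - m ^ 2 / u * φ u ^ 2) u := by
  have h := ((hP.const_mul (-4)).mul hder)
  exact h.congr_deriv (by ring)

/-- **Biot–Savart pairing, integrated.**  `φ, u·φ₁` continuous on `[0,U]`, `φ′ = φ₁` and `(uφ₁)′ = ((m²/u)φ − a)/4` on `(0,U)`, `φ(U) = 0`,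
integrands interval-integrable: `∫₀^U aφ = ∫₀^U (4u φ₁² + (m²/u) φ²)`. -/
theorem bsPairing_integral {m U : ℝ} {a φ φ₁ : ℝ → ℝ} (hU : 0 ≤ U)
    (hφ : ContinuousOn φ (Icc 0 U)) (hP : ContinuousOn (fun s => s * φ₁ s) (Icc 0 U))
    (hder : ∀ u ∈ Ioo 0 U, HasDerivAt φ (φ₁ u) u)
    (hflux : ∀ u ∈ Ioo 0 U, HasDerivAt (fun s => s * φ₁ s) ((m ^ 2 / u * φ u - a u) / 4) u)
    (hφU : φ U = 0)
    (hIaφ : IntervalIntegrable (fun u => a u * φ u) volume 0 U)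
    (hIB : IntervalIntegrable (fun u => 4 * u * φ₁ u ^ 2 + m ^ 2 / u * φ u ^ 2) volume 0 U) :
    ∫ u in (0:ℝ)..U, a u * φ u = ∫ u in (0:ℝ)..U, (4 * u * φ₁ u ^ 2 + m ^ 2 / u * φ u ^ 2) := by
  have hcont : ContinuousOn (fun s => -4 * (s * φ₁ s) * φ s) (Icc 0 U) := (continuousOn_const.mul hP).mul hφ
  have hderiv : ∀ u ∈ Ioo 0 U,
      HasDerivAt (fun s => -4 * (s * φ₁ s) * φ s) (a u * φ u - 4 * u * φ₁ u ^ 2 - m ^ 2 / u * φ u ^ 2) u :=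
    fun u hu => bsPairing_hasDerivAt (hder u hu) (hflux u hu)
  have hint : IntervalIntegrable (fun u => a u * φ u - 4 * u * φ₁ u ^ 2 - m ^ 2 / u * φ u ^ 2) volume 0 U := by
    have e : (fun u => a u * φ u - 4 * u * φ₁ u ^ 2 - m ^ 2 / u * φ u ^ 2)
        = fun u => a u * φ u - (4 * u * φ₁ u ^ 2 + m ^ 2 / u * φ u ^ 2) := by
      funext u; ring
    rw [e]; exact hIaφ.sub hIB
  have hFTC := integral_eq_sub_of_hasDerivAt_of_le hU hcont hderiv hint
  have hFU : -4 * (U * φ₁ U) * φ U = 0 := by rw [hφU]; ring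
  have hF0 : -4 * ((0:ℝ) * φ₁ 0) * φ 0 = 0 := by ring
  rw [hFU, hF0, sub_zero] at hFTC
  have hsplit : ∫ u in (0:ℝ)..U, (a u * φ u - 4 * u * φ₁ u ^ 2 - m ^ 2 / u * φ u ^ 2)
      = (∫ u in (0:ℝ)..U, a u * φ u) - ∫ u in (0:ℝ)..U, (4 * u * φ₁ u ^ 2 + m ^ 2 / u * φ u ^ 2) := by
    rw [← integral_sub hIaφ hIB]
    congr 1; funext u; ring
  have : (∫ u in (0:ℝ)..U, a u * φ u) - ∫ u in (0:ℝ)..U, (4 * u * φ₁ u ^ 2 + m ^ 2 / u * φ u ^ 2) = 0 := by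
    rw [← hsplit]; exact hFTC
  linarith

/-- **The Biot–Savart pairing is dominated by `(1/m²)∫ u a²`** (pointwise AM–GM `aφ ≤ (u a²/m² + m²φ²/u)/2` plus `∫(m²/u)φ² ≤ ∫aφ`):
under the hypotheses of `bsPairing_integral` with `m ≠ 0` and `φ(0) = 0`, `0 ≤ ∫₀^U aφ ≤ (1/m²)∫₀^U u a²`. -/
theorem bsPairing_le {m U : ℝ} {a φ φ₁ : ℝ → ℝ} (hm : m ≠ 0) (hU : 0 ≤ U)
    (hφ : ContinuousOn φ (Icc 0 U)) (hP : ContinuousOn (fun s => s * φ₁ s) (Icc 0 U)) (hφ0 : φ 0 = 0)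
    (hder : ∀ u ∈ Ioo 0 U, HasDerivAt φ (φ₁ u) u)
    (hflux : ∀ u ∈ Ioo 0 U, HasDerivAt (fun s => s * φ₁ s) ((m ^ 2 / u * φ u - a u) / 4) u)
    (hφU : φ U = 0)
    (hIaφ : IntervalIntegrable (fun u => a u * φ u) volume 0 U)
    (hIB₁ : IntervalIntegrable (fun u => 4 * u * φ₁ u ^ 2) volume 0 U)
    (hIB₂ : IntervalIntegrable (fun u => m ^ 2 / u * φ u ^ 2) volume 0 U)
    (hIua : IntervalIntegrable (fun u => u * a u ^ 2) volume 0 U) :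
    0 ≤ ∫ u in (0:ℝ)..U, a u * φ u ∧ ∫ u in (0:ℝ)..U, a u * φ u ≤ 1 / m ^ 2 * ∫ u in (0:ℝ)..U, u * a u ^ 2 := by
  have hm2 : 0 < m ^ 2 := by positivity
  have hid := bsPairing_integral hU hφ hP hder hflux hφU hIaφ (hIB₁.add hIB₂)
  have hB₁ : 0 ≤ ∫ u in (0:ℝ)..U, 4 * u * φ₁ u ^ 2 :=
    integral_nonneg hU (fun u hu => by have := hu.1; positivity)
  have hB₂ : 0 ≤ ∫ u in (0:ℝ)..U, m ^ 2 / u * φ u ^ 2 :=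
    integral_nonneg hU (fun u hu => by have := hu.1; positivity)
  have hsum : ∫ u in (0:ℝ)..U, (4 * u * φ₁ u ^ 2 + m ^ 2 / u * φ u ^ 2)
      = (∫ u in (0:ℝ)..U, 4 * u * φ₁ u ^ 2) + ∫ u in (0:ℝ)..U, m ^ 2 / u * φ u ^ 2 := integral_add hIB₁ hIB₂
  refine ⟨by rw [hid, hsum]; linarith, ?_⟩
  -- AM–GM pointwise: `aφ ≤ (u a²/m² + (m²/u)φ²)/2` on `[0, U]`
  have hamgm : ∫ u in (0:ℝ)..U, a u * φ u ≤ ∫ u in (0:ℝ)..U, ((1 / m ^ 2) * (u * a u ^ 2) + m ^ 2 / u * φ u ^ 2) / 2 := by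
    apply integral_mono_on hU hIaφ (((hIua.const_mul (1 / m ^ 2)).add hIB₂).div_const 2)
    intro u hu
    rcases eq_or_lt_of_le hu.1 with h | h
    · subst h; simp [hφ0]
    · have key : 0 ≤ (u * a u - m ^ 2 * φ u) ^ 2 / (2 * m ^ 2 * u) := by positivity
      have e : ((1 / m ^ 2) * (u * a u ^ 2) + m ^ 2 / u * φ u ^ 2) / 2 - a u * φ u
          = (u * a u - m ^ 2 * φ u) ^ 2 / (2 * m ^ 2 * u) := by
        field_simp; ring
      linarith [e, key]
  have hsplit : ∫ u in (0:ℝ)..U, ((1 / m ^ 2) * (u * a u ^ 2) + m ^ 2 / u * φ u ^ 2) / 2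
      = ((1 / m ^ 2) * (∫ u in (0:ℝ)..U, u * a u ^ 2) + ∫ u in (0:ℝ)..U, m ^ 2 / u * φ u ^ 2) / 2 := by
    rw [intervalIntegral.integral_div, integral_add (hIua.const_mul _) hIB₂, intervalIntegral.integral_const_mul]
  rw [hsplit] at hamgm
  -- `∫(m²/u)φ² ≤ ∫aφ`
  have hB₂le : ∫ u in (0:ℝ)..U, m ^ 2 / u * φ u ^ 2 ≤ ∫ u in (0:ℝ)..U, a u * φ u := by rw [hid, hsum]; linarith
  linarith

/-! ## 3. The core rotation identity and coercivity (Biot–Savart-coupled block, Gaussian weight) -/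

/-- **Core rotation identity.**  For the Biot–Savart-coupled azimuthal block (module docstring) with `a, b, Φ_a, Φ_b` continuous on `[0,U]`,
`a(U) = b(U) = 0`, and the integrands interval-integrable:
`∫₀^U e^{γu/4} V (a²+b²) = ∫₀^U e^{γu/4}(a f₂ − b f₁) + (γ²mRc/8π) ∫₀^U (aφ_a + bφ_b)`. -/
theorem core_rotation_identity {γ m ρ Rc U : ℝ} {a a₁ b b₁ φa φb f₁ f₂ : ℝ → ℝ} (hU : 0 ≤ U)
    (ha : ContinuousOn a (Icc 0 U)) (hb : ContinuousOn b (Icc 0 U))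
    (hΦac : ContinuousOn (fun s => 4 * s * a₁ s + γ * s * a s) (Icc 0 U))
    (hΦbc : ContinuousOn (fun s => 4 * s * b₁ s + γ * s * b s) (Icc 0 U))
    (hdera : ∀ u ∈ Ioo 0 U, HasDerivAt a (a₁ u) u) (hderb : ∀ u ∈ Ioo 0 U, HasDerivAt b (b₁ u) u)
    (hΦa : ∀ u ∈ Ioo 0 U, HasDerivAt (fun s => 4 * s * a₁ s + γ * s * a s)
      (m ^ 2 / u * a u - m * (ρ + Rc * ((1 - Real.exp (-(γ * u / 4))) / (2 * Real.pi * u))) * b u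
        + γ * m * Rc / 2 * (γ / (4 * Real.pi) * Real.exp (-(γ * u / 4))) * φb u - f₁ u) u)
    (hΦb : ∀ u ∈ Ioo 0 U, HasDerivAt (fun s => 4 * s * b₁ s + γ * s * b s)
      (m ^ 2 / u * b u + m * (ρ + Rc * ((1 - Real.exp (-(γ * u / 4))) / (2 * Real.pi * u))) * a u
        - γ * m * Rc / 2 * (γ / (4 * Real.pi) * Real.exp (-(γ * u / 4))) * φa u - f₂ u) u)
    (haU : a U = 0) (hbU : b U = 0)
    (hIV : IntervalIntegrable (fun u => Real.exp (γ * u / 4)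
      * (m * (ρ + Rc * ((1 - Real.exp (-(γ * u / 4))) / (2 * Real.pi * u))) * (a u ^ 2 + b u ^ 2))) volume 0 U)
    (hIf : IntervalIntegrable (fun u => Real.exp (γ * u / 4) * (a u * f₂ u - b u * f₁ u)) volume 0 U)
    (hIbs : IntervalIntegrable (fun u => a u * φa u + b u * φb u) volume 0 U) :
    ∫ u in (0:ℝ)..U, Real.exp (γ * u / 4)
        * (m * (ρ + Rc * ((1 - Real.exp (-(γ * u / 4))) / (2 * Real.pi * u))) * (a u ^ 2 + b u ^ 2))
      = (∫ u in (0:ℝ)..U, Real.exp (γ * u / 4) * (a u * f₂ u - b u * f₁ u))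
        + γ ^ 2 * m * Rc / (8 * Real.pi) * ∫ u in (0:ℝ)..U, (a u * φa u + b u * φb u) := by
  have hπ : Real.pi ≠ 0 := Real.pi_pos.ne'
  -- names
  set V : ℝ → ℝ := fun u => m * (ρ + Rc * ((1 - Real.exp (-(γ * u / 4))) / (2 * Real.pi * u))) with hVdef
  set cB : ℝ → ℝ := fun u => γ * m * Rc / 2 * (γ / (4 * Real.pi) * Real.exp (-(γ * u / 4))) with hcBdef
  set F₁ : ℝ → ℝ := fun u => f₁ u - cB u * φb u with hF₁def
  set F₂ : ℝ → ℝ := fun u => f₂ u + cB u * φa u with hF₂def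
  -- the Gaussian weight kills the Biot–Savart decay: `E · c_B ≡ γ² m Rc/(8π)`
  have hEcB : ∀ u, Real.exp (γ * u / 4) * cB u = γ ^ 2 * m * Rc / (8 * Real.pi) := by
    intro u
    simp only [hcBdef]
    have hE : Real.exp (γ * u / 4) ≠ 0 := (Real.exp_pos _).ne'
    rw [Real.exp_neg]
    field_simp
    ring
  -- the antiderivative
  set Fl : ℝ → ℝ := fun s => Real.exp (γ * s / 4)
      * (a s * (4 * s * b₁ s + γ * s * b s) - b s * (4 * s * a₁ s + γ * s * a s)) with hFldef
  have hcont : ContinuousOn Fl (Icc 0 U) := by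
    have hE : ContinuousOn (fun s : ℝ => Real.exp (γ * s / 4)) (Icc 0 U) :=
      (Real.continuous_exp.comp (by continuity)).continuousOn
    exact hE.mul ((ha.mul hΦbc).sub (hb.mul hΦac))
  have hderiv : ∀ u ∈ Ioo 0 U, HasDerivAt Fl
      (Real.exp (γ * u / 4) * (V u * (a u ^ 2 + b u ^ 2) - (a u * F₂ u - b u * F₁ u))) u := by
    intro u hu
    have hA : HasDerivAt (fun s => 4 * s * a₁ s + γ * s * a s) (m ^ 2 / u * a u - V u * b u - F₁ u) u :=
      (hΦa u hu).congr_deriv (by simp only [hVdef, hF₁def, hcBdef]; ring)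
    have hB : HasDerivAt (fun s => 4 * s * b₁ s + γ * s * b s) (m ^ 2 / u * b u + V u * a u - F₂ u) u :=
      (hΦb u hu).congr_deriv (by simp only [hVdef, hF₂def, hcBdef]; ring)
    exact rotationFlux_gauss_hasDerivAt (hdera u hu) (hderb u hu) hA hB
  -- the integrand, rewritten
  have hint_eq : ∀ u, Real.exp (γ * u / 4) * (V u * (a u ^ 2 + b u ^ 2) - (a u * F₂ u - b u * F₁ u))
      = Real.exp (γ * u / 4) * (V u * (a u ^ 2 + b u ^ 2))
        - Real.exp (γ * u / 4) * (a u * f₂ u - b u * f₁ u)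
        - γ ^ 2 * m * Rc / (8 * Real.pi) * (a u * φa u + b u * φb u) := by
    intro u
    have h := hEcB u
    simp only [hF₁def, hF₂def]
    linear_combination (-(a u * φa u + b u * φb u)) * h
  have hint : IntervalIntegrable (fun u => Real.exp (γ * u / 4)
      * (V u * (a u ^ 2 + b u ^ 2) - (a u * F₂ u - b u * F₁ u))) volume 0 U := by
    have e : (fun u => Real.exp (γ * u / 4) * (V u * (a u ^ 2 + b u ^ 2) - (a u * F₂ u - b u * F₁ u)))
        = fun u => Real.exp (γ * u / 4) * (V u * (a u ^ 2 + b u ^ 2))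
          - Real.exp (γ * u / 4) * (a u * f₂ u - b u * f₁ u)
          - γ ^ 2 * m * Rc / (8 * Real.pi) * (a u * φa u + b u * φb u) := by
      funext u; exact hint_eq u
    rw [e]
    exact (hIV.sub hIf).sub (hIbs.const_mul (γ ^ 2 * m * Rc / (8 * Real.pi)))
  have hFTC := integral_eq_sub_of_hasDerivAt_of_le hU hcont hderiv hint
  have hFlU : Fl U = 0 := by simp [hFldef, haU, hbU]
  have hFl0 : Fl 0 = 0 := by simp [hFldef]
  rw [hFlU, hFl0, sub_zero] at hFTC
  have hsplit : ∫ u in (0:ℝ)..U, Real.exp (γ * u / 4) * (V u * (a u ^ 2 + b u ^ 2) - (a u * F₂ u - b u * F₁ u))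
      = (∫ u in (0:ℝ)..U, Real.exp (γ * u / 4) * (V u * (a u ^ 2 + b u ^ 2)))
        - (∫ u in (0:ℝ)..U, Real.exp (γ * u / 4) * (a u * f₂ u - b u * f₁ u))
        - γ ^ 2 * m * Rc / (8 * Real.pi) * ∫ u in (0:ℝ)..U, (a u * φa u + b u * φb u) := by
    rw [← intervalIntegral.integral_const_mul, ← integral_sub hIV hIf,
      ← integral_sub (hIV.sub hIf) (hIbs.const_mul _)]
    congr 1; funext u; rw [hint_eq u]
  rw [hsplit] at hFTC
  linarith

set_option maxHeartbeats 800000 in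
/-- **Core rotation coercivity (Gaussian weight, `m ≥ 2`, every `Rc ≥ 0`).**  Under the hypotheses of `core_rotation_identity` plus the
`m`-Poisson relations for `φ_a, φ_b` (flux form, `φ_a(U) = φ_b(U) = 0`) and interval-integrability of the occurring integrands:
`(1 − 16/(5m²))·m Rc ∫₀^U e^{γu/4} Ω (a²+b²) + mρ ∫₀^U e^{γu/4}(a²+b²) ≤ ∫₀^U e^{γu/4}(a f₂ − b f₁)`, `Ω = (1 − e^{−γu/4})/(2πu)`. -/
theorem core_rotation_coercivity {γ m ρ Rc U : ℝ} {a a₁ b b₁ φa φa₁ φb φb₁ f₁ f₂ : ℝ → ℝ}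
    (hγ : 0 < γ) (hm : 2 ≤ m) (hRc : 0 ≤ Rc) (hU : 0 ≤ U)
    (ha : ContinuousOn a (Icc 0 U)) (hb : ContinuousOn b (Icc 0 U))
    (hφa : ContinuousOn φa (Icc 0 U)) (hφb : ContinuousOn φb (Icc 0 U))
    (hΦac : ContinuousOn (fun s => 4 * s * a₁ s + γ * s * a s) (Icc 0 U))
    (hΦbc : ContinuousOn (fun s => 4 * s * b₁ s + γ * s * b s) (Icc 0 U))
    (hPac : ContinuousOn (fun s => s * φa₁ s) (Icc 0 U)) (hPbc : ContinuousOn (fun s => s * φb₁ s) (Icc 0 U))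
    (hφa0 : φa 0 = 0) (hφb0 : φb 0 = 0)
    (hdera : ∀ u ∈ Ioo 0 U, HasDerivAt a (a₁ u) u) (hderb : ∀ u ∈ Ioo 0 U, HasDerivAt b (b₁ u) u)
    (hderφa : ∀ u ∈ Ioo 0 U, HasDerivAt φa (φa₁ u) u) (hderφb : ∀ u ∈ Ioo 0 U, HasDerivAt φb (φb₁ u) u)
    (hΦa : ∀ u ∈ Ioo 0 U, HasDerivAt (fun s => 4 * s * a₁ s + γ * s * a s)
      (m ^ 2 / u * a u - m * (ρ + Rc * ((1 - Real.exp (-(γ * u / 4))) / (2 * Real.pi * u))) * b u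
        + γ * m * Rc / 2 * (γ / (4 * Real.pi) * Real.exp (-(γ * u / 4))) * φb u - f₁ u) u)
    (hΦb : ∀ u ∈ Ioo 0 U, HasDerivAt (fun s => 4 * s * b₁ s + γ * s * b s)
      (m ^ 2 / u * b u + m * (ρ + Rc * ((1 - Real.exp (-(γ * u / 4))) / (2 * Real.pi * u))) * a u
        - γ * m * Rc / 2 * (γ / (4 * Real.pi) * Real.exp (-(γ * u / 4))) * φa u - f₂ u) u)
    (hPa : ∀ u ∈ Ioo 0 U, HasDerivAt (fun s => s * φa₁ s) ((m ^ 2 / u * φa u - a u) / 4) u)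
    (hPb : ∀ u ∈ Ioo 0 U, HasDerivAt (fun s => s * φb₁ s) ((m ^ 2 / u * φb u - b u) / 4) u)
    (haU : a U = 0) (hbU : b U = 0) (hφaU : φa U = 0) (hφbU : φb U = 0)
    (hIΩ : IntervalIntegrable (fun u => Real.exp (γ * u / 4)
      * ((1 - Real.exp (-(γ * u / 4))) / (2 * Real.pi * u)) * (a u ^ 2 + b u ^ 2)) volume 0 U)
    (hIE : IntervalIntegrable (fun u => Real.exp (γ * u / 4) * (a u ^ 2 + b u ^ 2)) volume 0 U)
    (hIf : IntervalIntegrable (fun u => Real.exp (γ * u / 4) * (a u * f₂ u - b u * f₁ u)) volume 0 U)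
    (hIaφ : IntervalIntegrable (fun u => a u * φa u) volume 0 U)
    (hIbφ : IntervalIntegrable (fun u => b u * φb u) volume 0 U)
    (hIBa₁ : IntervalIntegrable (fun u => 4 * u * φa₁ u ^ 2) volume 0 U)
    (hIBa₂ : IntervalIntegrable (fun u => m ^ 2 / u * φa u ^ 2) volume 0 U)
    (hIBb₁ : IntervalIntegrable (fun u => 4 * u * φb₁ u ^ 2) volume 0 U)
    (hIBb₂ : IntervalIntegrable (fun u => m ^ 2 / u * φb u ^ 2) volume 0 U)
    (hIua : IntervalIntegrable (fun u => u * a u ^ 2) volume 0 U)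
    (hIub : IntervalIntegrable (fun u => u * b u ^ 2) volume 0 U) :
    (1 - 16 / (5 * m ^ 2)) * (m * Rc) * (∫ u in (0:ℝ)..U, Real.exp (γ * u / 4)
        * ((1 - Real.exp (-(γ * u / 4))) / (2 * Real.pi * u)) * (a u ^ 2 + b u ^ 2))
      + m * ρ * (∫ u in (0:ℝ)..U, Real.exp (γ * u / 4) * (a u ^ 2 + b u ^ 2))
      ≤ ∫ u in (0:ℝ)..U, Real.exp (γ * u / 4) * (a u * f₂ u - b u * f₁ u) := by
  have hm0 : 0 < m := by linarith
  have hm0' : m ≠ 0 := hm0.ne'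
  have hπ : 0 < Real.pi := Real.pi_pos
  -- the V-integrand splits as `mρ·E s + mRc·EΩ s`
  have hIV : IntervalIntegrable (fun u => Real.exp (γ * u / 4)
      * (m * (ρ + Rc * ((1 - Real.exp (-(γ * u / 4))) / (2 * Real.pi * u))) * (a u ^ 2 + b u ^ 2))) volume 0 U := by
    have e : (fun u => Real.exp (γ * u / 4)
        * (m * (ρ + Rc * ((1 - Real.exp (-(γ * u / 4))) / (2 * Real.pi * u))) * (a u ^ 2 + b u ^ 2)))
        = fun u => m * ρ * (Real.exp (γ * u / 4) * (a u ^ 2 + b u ^ 2))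
          + m * Rc * (Real.exp (γ * u / 4) * ((1 - Real.exp (-(γ * u / 4))) / (2 * Real.pi * u)) * (a u ^ 2 + b u ^ 2)) := by
      funext u; ring
    rw [e]
    exact (hIE.const_mul (m * ρ)).add (hIΩ.const_mul (m * Rc))
  have hVsplit : ∫ u in (0:ℝ)..U, Real.exp (γ * u / 4)
      * (m * (ρ + Rc * ((1 - Real.exp (-(γ * u / 4))) / (2 * Real.pi * u))) * (a u ^ 2 + b u ^ 2))
      = m * ρ * (∫ u in (0:ℝ)..U, Real.exp (γ * u / 4) * (a u ^ 2 + b u ^ 2))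
        + m * Rc * (∫ u in (0:ℝ)..U, Real.exp (γ * u / 4)
          * ((1 - Real.exp (-(γ * u / 4))) / (2 * Real.pi * u)) * (a u ^ 2 + b u ^ 2)) := by
    rw [← intervalIntegral.integral_const_mul, ← intervalIntegral.integral_const_mul,
      ← integral_add (hIE.const_mul _) (hIΩ.const_mul _)]
    congr 1; funext u; ring
  -- (1) the identity
  have hid := core_rotation_identity hU ha hb hΦac hΦbc hdera hderb hΦa hΦb haU hbU hIV hIf (hIaφ.add hIbφ)
  -- (2) the Biot–Savart pairing bound `0 ≤ ∫(aφa + bφb) ≤ (1/m²)∫u(a²+b²)`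
  have hBa := bsPairing_le hm0' hU hφa hPac hφa0 hderφa hPa hφaU hIaφ hIBa₁ hIBa₂ hIua
  have hBb := bsPairing_le hm0' hU hφb hPbc hφb0 hderφb hPb hφbU hIbφ hIBb₁ hIBb₂ hIub
  have hbs_sum : ∫ u in (0:ℝ)..U, (a u * φa u + b u * φb u)
      = (∫ u in (0:ℝ)..U, a u * φa u) + ∫ u in (0:ℝ)..U, b u * φb u := integral_add hIaφ hIbφ
  -- (3) pointwise: `(γ²mRc/8π)·(1/m²)·u·s ≤ (16/(5m²))·mRc·EΩ·s`
  have hcomp : γ ^ 2 * m * Rc / (8 * Real.pi) * (1 / m ^ 2) * ((∫ u in (0:ℝ)..U, u * a u ^ 2) + ∫ u in (0:ℝ)..U, u * b u ^ 2)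
      ≤ 16 / (5 * m ^ 2) * (m * Rc) * (∫ u in (0:ℝ)..U, Real.exp (γ * u / 4)
          * ((1 - Real.exp (-(γ * u / 4))) / (2 * Real.pi * u)) * (a u ^ 2 + b u ^ 2)) := by
    rw [← integral_add hIua hIub, ← intervalIntegral.integral_const_mul, ← intervalIntegral.integral_const_mul]
    apply integral_mono_on hU ((hIua.add hIub).const_mul _) (hIΩ.const_mul _)
    intro u hu
    have hs : 0 ≤ a u ^ 2 + b u ^ 2 := by positivity
    have hpt := bs_rotation_pointwise hγ hm hu.1
    -- `E·(1 − e^{−γu/4}) = E − 1`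
    have hE : Real.exp (γ * u / 4) * ((1 - Real.exp (-(γ * u / 4))) / (2 * Real.pi * u))
        = (Real.exp (γ * u / 4) - 1) / (2 * Real.pi * u) := by
      have : Real.exp (γ * u / 4) * Real.exp (-(γ * u / 4)) = 1 := by rw [← Real.exp_add]; simp
      rw [mul_div_assoc', mul_sub, mul_one, this]
    have lhs_eq : γ ^ 2 * m * Rc / (8 * Real.pi) * (1 / m ^ 2) * (u * a u ^ 2 + u * b u ^ 2)
        = Rc * (γ ^ 2 / (8 * Real.pi * m) * u) * (a u ^ 2 + b u ^ 2) := by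
      field_simp
    have rhs_eq : 16 / (5 * m ^ 2) * (m * Rc) * (Real.exp (γ * u / 4)
          * ((1 - Real.exp (-(γ * u / 4))) / (2 * Real.pi * u)) * (a u ^ 2 + b u ^ 2))
        = Rc * (16 / (5 * m ^ 2) * m * ((Real.exp (γ * u / 4) - 1) / (2 * Real.pi * u))) * (a u ^ 2 + b u ^ 2) := by
      rw [hE]; ring
    rw [lhs_eq, rhs_eq]
    exact mul_le_mul_of_nonneg_right (mul_le_mul_of_nonneg_left hpt hRc) hs
  -- assemble
  have hRcm : 0 ≤ γ ^ 2 * m * Rc / (8 * Real.pi) := by positivity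
  have hbs_le : γ ^ 2 * m * Rc / (8 * Real.pi) * ∫ u in (0:ℝ)..U, (a u * φa u + b u * φb u)
      ≤ 16 / (5 * m ^ 2) * (m * Rc) * (∫ u in (0:ℝ)..U, Real.exp (γ * u / 4)
          * ((1 - Real.exp (-(γ * u / 4))) / (2 * Real.pi * u)) * (a u ^ 2 + b u ^ 2)) := by
    have h1 : ∫ u in (0:ℝ)..U, (a u * φa u + b u * φb u)
        ≤ (1 / m ^ 2) * ((∫ u in (0:ℝ)..U, u * a u ^ 2) + ∫ u in (0:ℝ)..U, u * b u ^ 2) := by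
      rw [hbs_sum]; nlinarith [hBa.2, hBb.2]
    have h2 := mul_le_mul_of_nonneg_left h1 hRcm
    calc γ ^ 2 * m * Rc / (8 * Real.pi) * ∫ u in (0:ℝ)..U, (a u * φa u + b u * φb u)
        ≤ γ ^ 2 * m * Rc / (8 * Real.pi) * ((1 / m ^ 2) * ((∫ u in (0:ℝ)..U, u * a u ^ 2) + ∫ u in (0:ℝ)..U, u * b u ^ 2)) := h2
      _ = γ ^ 2 * m * Rc / (8 * Real.pi) * (1 / m ^ 2) * ((∫ u in (0:ℝ)..U, u * a u ^ 2) + ∫ u in (0:ℝ)..U, u * b u ^ 2) := by ring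
      _ ≤ _ := hcomp
  rw [hVsplit] at hid
  nlinarith [hid, hbs_le, hBa.1, hBb.1]

end Summit.NavierStokesRegularity.NavierStokesRegularity.Theorems.DefectColumnGate

end
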